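import Mathlib
import HarnessLib
import Summits.HubbardSuperconductivity.HubbardSuperconductivity.Theorems.KLProgrammeC4aPPKernelMidCalculus

/-!
# Route `KLProgramme` — crux C4a, S3 brick (B4) «(B4)-UMK1», «(U1)-M-LAW» kernel side: the ANTI-DIAGONAL FLATNESS IDENTITY for the smooth
# comparable-levels piece `M` — `D²·∫_{lo}^{hi} ∂ᵤM(e, D−e) de = ∫_{lo}^{hi} [E_N·μ + N·m′(r)·ρ] de − [e·N·μ]_{lo}^{hi}` (Euler scaling defects + one integration by parts)

Cell `gate-hubbard-kl`, seat hubbard-kl-k3c3-p1 (g17; row «δμ-flow with klAngularMean constant piece»).  Part 5 of the M-rows for k3c3-p3's «(U1)-M-LAW» (pen (R384)(A)(b):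
«NAME the `hflatTail`/band-flatness shape you can prove» — this file is the exact identity behind the `lo/D²`-class CONSTANT-WEIGHT flatness of `M`; the
sizes are part 6, `…C4aPPKernelMidFlatness`).  Along the anti-diagonal `u = D − e` (`D > 0` FIXED, so `e + u = D` and `P = N/D` with no singularity) write
`n(e) = N(e,D−e)`, `μ(e) = 1 − κ(r) − κ(1−r)` (`r = r(e,D−e) = m̃ₑ/(m̃ₑ+m̃ᵤ)`), `Φ(e) = e·n(e)·μ(e)`.  The SCALING (Euler) defects
`E_N = e∂ₑN + u∂ᵤN` (thermally small when both lines are far, part 6) and `ρ = e∂ₑr + u∂ᵤr = lo²(e²−u²)/(m̃ₑm̃ᵤ(m̃ₑ+m̃ᵤ)²)` (the floor's scale breaking, `O(lo²/M²)`)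
satisfy `D·∂ᵤN = E_N − e·n′` and `D·∂ᵤr = ρ − e·(r∘antidiag)′` (`n′ = ∂ₑN − ∂ᵤN`, `…TrueFlatness.hasDerivAt_ppTrueNumerator_line`), whence POINTWISE
`D²·∂ᵤM(e,D−e) = E_N·μ + n·m′(r)·ρ − Φ′(e)` and, integrating, the identity of the title: the flatness of `M` is `1/D²` times (scaling defects + boundary terms) —
for an exactly scale-invariant kernel only the boundary terms `lo·n(lo)μ(lo) − hi·n(hi)μ(hi)` would survive (the δμ-flow / constant-piece mechanism of this row).
* §1 `hasDerivAt_ppSmoothRatio_antidiag` (`d/de r(e,D−e)`), `ppSmoothRatio_euler_identity` (`e∂ₑr + u∂ᵤr = ρ`);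
* §2 `hasDerivAt_midFactor_antidiag` (`μ′`), `hasDerivAt_midPhi_antidiag` (`Φ′ = nμ + e n′μ + e n μ′`);
* §3 **`midFlatness_pointwise_identity`** (`D²·∂ᵤM(e,D−e) = E_Nμ + n·m′ρ − Φ′`);
* §4 continuity of the pieces and **`midFlatness_integral_identity`** (THE IDENTITY, any `0 < lo`, any `a, b`, any `D > 0`);
* §5 tools for part 6: `mul_exp_neg_le_inv`, `integral_beta_mul_exp_le`, `integral_beta_abs_exp_le` (`∫_c^d β|x|e^{−β|x|} ≤ 2/β`), `intervalIntegral_const_div_sq_le`.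
Pure real analysis; nothing asserts (C), K3, the window or superconductivity.
References: BGM 2006 §2.4 (2.36) [cite: BenfattoGiulianiMastropietro2006]; FST II CPAM 51 (1998) §3 [cite: FeldmanSalmhoferTrubowitz1998].
-/

noncomputable section

namespace Summit.HubbardSuperconductivity.HubbardSuperconductivity.Theorems.C4a

set_option linter.dupNamespace false -- summit = problem name (single-conjunct summit), D-0017

open Real Filter Set MeasureTheory intervalIntegral
open scoped Topology Interval
open Literature.MathematicalPhysics.QuantumLattice Literature.Analysis.SpecialFunctions

/-! ## §1 The ratio along the anti-diagonal and its Euler defect -/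

/-- **`d/de r(e, D−e) = ((e/m̃ₑ)·m̃ᵤ + m̃ₑ·(u/m̃ᵤ))/(m̃ₑ+m̃ᵤ)²`**, `u = D − e` (`= ∂ₑr − ∂ᵤr`). [folklore] -/
theorem hasDerivAt_ppSmoothRatio_antidiag {lo : ℝ} (hlo : 0 < lo) (D e : ℝ) :
    HasDerivAt (fun x : ℝ => ppSmoothRatio lo x (D - x))
      (((e / ppSmoothScale lo e) * ppSmoothScale lo (D - e) + ppSmoothScale lo e * ((D - e) / ppSmoothScale lo (D - e))) /
        (ppSmoothScale lo e + ppSmoothScale lo (D - e)) ^ 2) e := by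
  have h1 := ppSmoothScale_pos hlo e
  have h2 := ppSmoothScale_pos hlo (D - e)
  have ha : HasDerivAt (fun x : ℝ => ppSmoothScale lo x) (e / ppSmoothScale lo e) e := hasDerivAt_ppSmoothScale hlo e
  have hb : HasDerivAt (fun x : ℝ => ppSmoothScale lo (D - x)) ((D - e) / ppSmoothScale lo (D - e) * (-1)) e := by
    have h := (hasDerivAt_ppSmoothScale hlo (D - e)).comp e ((hasDerivAt_id e).const_sub D)
    exact h
  unfold ppSmoothRatio
  have h := ha.fun_div (ha.fun_add hb) (by positivity)
  refine h.congr_deriv ?_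
  field_simp
  ring

/-- **Euler defect of the ratio**: `e·∂ₑr + u·∂ᵤr = lo²(e² − u²)/(m̃ₑm̃ᵤ(m̃ₑ+m̃ᵤ)²)` with `∂ₑr = (e/m̃ₑ)m̃ᵤ/(m̃ₑ+m̃ᵤ)²`, `∂ᵤr = −m̃ₑ(u/m̃ᵤ)/(m̃ₑ+m̃ᵤ)²`
(`m̃² = x² + lo²`: the floor breaks scale invariance at order `lo²`). [folklore] -/
theorem ppSmoothRatio_euler_identity {lo : ℝ} (hlo : 0 < lo) (e u : ℝ) :
    e * ((e / ppSmoothScale lo e) * ppSmoothScale lo u / (ppSmoothScale lo e + ppSmoothScale lo u) ^ 2) +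
        u * (-(ppSmoothScale lo e * (u / ppSmoothScale lo u)) / (ppSmoothScale lo e + ppSmoothScale lo u) ^ 2) =
      lo ^ 2 * (e ^ 2 - u ^ 2) / (ppSmoothScale lo e * ppSmoothScale lo u * (ppSmoothScale lo e + ppSmoothScale lo u) ^ 2) := by
  have h1 := ppSmoothScale_pos hlo e
  have h2 := ppSmoothScale_pos hlo u
  have hs1 := ppSmoothScale_sq lo e
  have hs2 := ppSmoothScale_sq lo u
  have key : e * ((e / ppSmoothScale lo e) * ppSmoothScale lo u / (ppSmoothScale lo e + ppSmoothScale lo u) ^ 2) +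
        u * (-(ppSmoothScale lo e * (u / ppSmoothScale lo u)) / (ppSmoothScale lo e + ppSmoothScale lo u) ^ 2) =
      (e ^ 2 * ppSmoothScale lo u ^ 2 - u ^ 2 * ppSmoothScale lo e ^ 2) /
        (ppSmoothScale lo e * ppSmoothScale lo u * (ppSmoothScale lo e + ppSmoothScale lo u) ^ 2) := by
    field_simp
    ring
  rw [key, hs1, hs2]
  congr 1
  ring

/-! ## §2 The factor and the boundary function along the anti-diagonal -/

section AlongLine

variable {β Λ : ℝ} (hβ : 0 < β) (hΛ : 0 < Λ) {B₁ : ℝ} (hB₁ : ∀ x, |deriv salmhoferCutoff x| ≤ B₁)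
  {κ κ' : ℝ → ℝ} (hκ : ∀ t, HasDerivAt κ (κ' t) t) {lo : ℝ} (hlo : 0 < lo) (D : ℝ)

include hκ hlo in
/-- **`μ′`**: `d/de[1 − κ(r) − κ(1−r)] = (κ′(1−r) − κ′(r))·d/de r(e,D−e)`. [folklore] -/
theorem hasDerivAt_midFactor_antidiag (e : ℝ) :
    HasDerivAt (fun x : ℝ => 1 - κ (ppSmoothRatio lo x (D - x)) - κ (1 - ppSmoothRatio lo x (D - x)))
      ((κ' (1 - ppSmoothRatio lo e (D - e)) - κ' (ppSmoothRatio lo e (D - e))) *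
        (((e / ppSmoothScale lo e) * ppSmoothScale lo (D - e) + ppSmoothScale lo e * ((D - e) / ppSmoothScale lo (D - e))) /
          (ppSmoothScale lo e + ppSmoothScale lo (D - e)) ^ 2)) e := by
  have hr := hasDerivAt_ppSmoothRatio_antidiag hlo D e
  have hk1 := (hκ _).comp e hr
  have hk2 := (hκ _).comp e (hr.const_sub 1)
  have h := ((hasDerivAt_const e (1 : ℝ)).fun_sub hk1).fun_sub hk2
  refine h.congr_deriv ?_
  ring

include hβ hΛ hB₁ hκ hlo in
/-- **`Φ′ = n·μ + e·n′·μ + e·n·μ′`** for `Φ(e) = e·N(e,D−e)·μ(e)`, `n′ = ∂ₑN − ∂ᵤN` (`hasDerivAt_ppTrueNumerator_line`). [cite: BenfattoGiulianiMastropietro2006, §2.4 (2.36)] -/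
theorem hasDerivAt_midPhi_antidiag (e : ℝ) :
    HasDerivAt (fun x : ℝ => x * ppTrueNumerator β Λ x (D - x) * (1 - κ (ppSmoothRatio lo x (D - x)) - κ (1 - ppSmoothRatio lo x (D - x))))
      (ppTrueNumerator β Λ e (D - e) * (1 - κ (ppSmoothRatio lo e (D - e)) - κ (1 - ppSmoothRatio lo e (D - e))) +
        e * (ppTrueNumeratorDu β Λ (D - e) e - ppTrueNumeratorDu β Λ e (D - e)) * (1 - κ (ppSmoothRatio lo e (D - e)) - κ (1 - ppSmoothRatio lo e (D - e))) +
        e * ppTrueNumerator β Λ e (D - e) * ((κ' (1 - ppSmoothRatio lo e (D - e)) - κ' (ppSmoothRatio lo e (D - e))) *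
          (((e / ppSmoothScale lo e) * ppSmoothScale lo (D - e) + ppSmoothScale lo e * ((D - e) / ppSmoothScale lo (D - e))) /
            (ppSmoothScale lo e + ppSmoothScale lo (D - e)) ^ 2))) e := by
  have hn := hasDerivAt_ppTrueNumerator_line hβ hΛ hB₁ D e
  have hμ := hasDerivAt_midFactor_antidiag hκ hlo D e
  have h := (((hasDerivAt_id e).fun_mul hn).fun_mul hμ)
  refine (h.congr_of_eventuallyEq (Eventually.of_forall fun x => by simp only [id])).congr_deriv ?_
  simp only [id]
  ring

end AlongLine

/-! ## §3 The pointwise identity -/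

section Pointwise

variable {β Λ : ℝ} (hβ : 0 < β) (hΛ : 0 < Λ) {B₁ : ℝ} (hB₁ : ∀ x, |deriv salmhoferCutoff x| ≤ B₁)
  {κ κ' : ℝ → ℝ} (hκ : ∀ t, HasDerivAt κ (κ' t) t) {lo : ℝ} (hlo : 0 < lo)

include hβ hΛ hB₁ hκ hlo in
/-- **THE POINTWISE FLATNESS IDENTITY** (`D ≠ 0`): `D²·∂ᵤM(e, D−e) = E_N·μ + n·(κ′(1−r) − κ′(r))·ρ − Φ′(e)` with
`E_N = e·∂ₑN(e,D−e) + (D−e)·∂ᵤN(e,D−e)`, `ρ = lo²(e² − (D−e)²)/(m̃ₑm̃ᵤ(m̃ₑ+m̃ᵤ)²)` and `Φ′` as in `hasDerivAt_midPhi_antidiag`.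
[cite: BenfattoGiulianiMastropietro2006, §2.4 (2.36)] -/
theorem midFlatness_pointwise_identity {D : ℝ} (hD : D ≠ 0) (e : ℝ) :
    D ^ 2 * deriv (fun v : ℝ => ppMidKernelS β Λ κ lo e v) (D - e) =
      (e * ppTrueNumeratorDu β Λ (D - e) e + (D - e) * ppTrueNumeratorDu β Λ e (D - e)) * (1 - κ (ppSmoothRatio lo e (D - e)) - κ (1 - ppSmoothRatio lo e (D - e))) +
        ppTrueNumerator β Λ e (D - e) * (κ' (1 - ppSmoothRatio lo e (D - e)) - κ' (ppSmoothRatio lo e (D - e))) *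
          (lo ^ 2 * (e ^ 2 - (D - e) ^ 2) / (ppSmoothScale lo e * ppSmoothScale lo (D - e) * (ppSmoothScale lo e + ppSmoothScale lo (D - e)) ^ 2)) -
        (ppTrueNumerator β Λ e (D - e) * (1 - κ (ppSmoothRatio lo e (D - e)) - κ (1 - ppSmoothRatio lo e (D - e))) +
          e * (ppTrueNumeratorDu β Λ (D - e) e - ppTrueNumeratorDu β Λ e (D - e)) * (1 - κ (ppSmoothRatio lo e (D - e)) - κ (1 - ppSmoothRatio lo e (D - e))) +
          e * ppTrueNumerator β Λ e (D - e) * ((κ' (1 - ppSmoothRatio lo e (D - e)) - κ' (ppSmoothRatio lo e (D - e))) *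
            (((e / ppSmoothScale lo e) * ppSmoothScale lo (D - e) + ppSmoothScale lo e * ((D - e) / ppSmoothScale lo (D - e))) /
              (ppSmoothScale lo e + ppSmoothScale lo (D - e)) ^ 2))) := by
  have hs : e + (D - e) ≠ 0 := by rw [add_sub_cancel]; exact hD
  have h1 := ppSmoothScale_pos hlo e
  have h2 := ppSmoothScale_pos hlo (D - e)
  rw [(hasDerivAt_ppMidKernelS_u hβ hΛ hB₁ hκ hlo e (D - e)).deriv, ppTrueKernelDu_eq_of_ne hβ hΛ hB₁ hs, ppTrueKernel_eq_div hβ Λ hs,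
    ← ppSmoothRatio_euler_identity hlo e (D - e)]
  rw [show e + (D - e) = D by ring]
  field_simp
  ring

end Pointwise

/-! ## §4 The integrated identity -/

section Integral

variable {β Λ : ℝ} (hβ : 0 < β) (hΛ : 0 < Λ) {B₁ : ℝ} (hB₁ : ∀ x, |deriv salmhoferCutoff x| ≤ B₁)
  {κ κ' : ℝ → ℝ} (hκ : ∀ t, HasDerivAt κ (κ' t) t) (hκ'c : Continuous κ') {lo : ℝ} (hlo : 0 < lo)

include hlo in
/-- The floor along the anti-diagonal is continuous and positive-sum: `e ↦ m̃ₑ + m̃_{D−e}` continuous, `> 0`. [folklore] -/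
theorem continuous_ppSmoothScale_sum_antidiag (D : ℝ) :
    Continuous (fun e : ℝ => ppSmoothScale lo e + ppSmoothScale lo (D - e)) ∧ ∀ e, 0 < ppSmoothScale lo e + ppSmoothScale lo (D - e) := by
  have hc : Continuous (ppSmoothScale lo) := (contDiff_ppSmoothScale hlo (n := 0)).continuous
  exact ⟨hc.add (hc.comp (continuous_const.sub continuous_id)), fun e => by
    have := ppSmoothScale_pos hlo e; have := ppSmoothScale_pos hlo (D - e); positivity⟩

include hκ hlo in
/-- `μ` is continuous along the anti-diagonal. [folklore] -/
theorem continuous_midFactor_antidiag (D : ℝ) : Continuous fun e : ℝ => 1 - κ (ppSmoothRatio lo e (D - e)) - κ (1 - ppSmoothRatio lo e (D - e)) := by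
  have hκc : Continuous κ := continuous_iff_continuousAt.2 fun t => (hκ t).continuousAt
  have hr : Continuous fun e : ℝ => ppSmoothRatio lo e (D - e) :=
    (continuous_ppSmoothRatio₂ hlo).comp (continuous_id.prodMk (continuous_const.sub continuous_id))
  exact (continuous_const.sub (hκc.comp hr)).sub (hκc.comp (continuous_const.sub hr))

include hκ'c hlo in
/-- `κ′(1−r) − κ′(r)` is continuous along the anti-diagonal. [folklore] -/
theorem continuous_midFactorD_antidiag (D : ℝ) : Continuous fun e : ℝ => κ' (1 - ppSmoothRatio lo e (D - e)) - κ' (ppSmoothRatio lo e (D - e)) := by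
  have hr : Continuous fun e : ℝ => ppSmoothRatio lo e (D - e) :=
    (continuous_ppSmoothRatio₂ hlo).comp (continuous_id.prodMk (continuous_const.sub continuous_id))
  exact (hκ'c.comp (continuous_const.sub hr)).sub (hκ'c.comp hr)

include hlo in
/-- `ρ` and `d/de r(e,D−e)` are continuous along the anti-diagonal. [folklore] -/
theorem continuous_euler_and_lineDeriv_antidiag (D : ℝ) :
    Continuous (fun e : ℝ => lo ^ 2 * (e ^ 2 - (D - e) ^ 2) / (ppSmoothScale lo e * ppSmoothScale lo (D - e) * (ppSmoothScale lo e + ppSmoothScale lo (D - e)) ^ 2)) ∧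
    Continuous (fun e : ℝ => ((e / ppSmoothScale lo e) * ppSmoothScale lo (D - e) + ppSmoothScale lo e * ((D - e) / ppSmoothScale lo (D - e))) /
      (ppSmoothScale lo e + ppSmoothScale lo (D - e)) ^ 2) := by
  have hc : Continuous (ppSmoothScale lo) := (contDiff_ppSmoothScale hlo (n := 0)).continuous
  have hce : Continuous fun e : ℝ => ppSmoothScale lo e := hc
  have hcu : Continuous fun e : ℝ => ppSmoothScale lo (D - e) := hc.comp (continuous_const.sub continuous_id)
  have hne : ∀ e : ℝ, ppSmoothScale lo e ≠ 0 := fun e => (ppSmoothScale_pos hlo e).ne'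
  have hnu : ∀ e : ℝ, ppSmoothScale lo (D - e) ≠ 0 := fun e => (ppSmoothScale_pos hlo (D - e)).ne'
  obtain ⟨hs, hspos⟩ := continuous_ppSmoothScale_sum_antidiag hlo D
  refine ⟨Continuous.div (by fun_prop) ((hce.mul hcu).mul (hs.pow 2)) fun e => ?_, Continuous.div ?_ (hs.pow 2) fun e => (pow_pos (hspos e) 2).ne'⟩
  · have := hne e; have := hnu e; have := hspos e; positivity
  · exact ((continuous_id.div hce hne).mul hcu).add (hce.mul ((continuous_const.sub continuous_id).div hcu hnu))

include hβ hΛ hB₁ hκ hκ'c hlo in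
/-- **THE ANTI-DIAGONAL FLATNESS IDENTITY FOR `M`** (`0 < D`, any `a b`):
`D²·∫_a^b ∂ᵤM(e, D−e) de = ∫_a^b [E_N(e)·μ(e) + n(e)·(κ′(1−r)−κ′(r))·ρ(e)] de − (Φ(b) − Φ(a))`, `Φ(e) = e·N(e,D−e)·μ(e)`.
[cite: BenfattoGiulianiMastropietro2006, §2.4 (2.36)] -/
theorem midFlatness_integral_identity {D : ℝ} (hD : 0 < D) (a b : ℝ) :
    D ^ 2 * ∫ e in a..b, deriv (fun v : ℝ => ppMidKernelS β Λ κ lo e v) (D - e) =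
      (∫ e in a..b, (e * ppTrueNumeratorDu β Λ (D - e) e + (D - e) * ppTrueNumeratorDu β Λ e (D - e)) *
          (1 - κ (ppSmoothRatio lo e (D - e)) - κ (1 - ppSmoothRatio lo e (D - e))) +
        ppTrueNumerator β Λ e (D - e) * (κ' (1 - ppSmoothRatio lo e (D - e)) - κ' (ppSmoothRatio lo e (D - e))) *
          (lo ^ 2 * (e ^ 2 - (D - e) ^ 2) / (ppSmoothScale lo e * ppSmoothScale lo (D - e) * (ppSmoothScale lo e + ppSmoothScale lo (D - e)) ^ 2))) -
      (b * ppTrueNumerator β Λ b (D - b) * (1 - κ (ppSmoothRatio lo b (D - b)) - κ (1 - ppSmoothRatio lo b (D - b))) -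
        a * ppTrueNumerator β Λ a (D - a) * (1 - κ (ppSmoothRatio lo a (D - a)) - κ (1 - ppSmoothRatio lo a (D - a)))) := by
  -- continuity of the pieces
  have hN : Continuous fun e : ℝ => ppTrueNumerator β Λ e (D - e) :=
    continuous_iff_continuousAt.2 fun e => (hasDerivAt_ppTrueNumerator_line hβ hΛ hB₁ D e).continuousAt
  have hDe := continuous_ppTrueNumeratorDe_line hβ hΛ hB₁ D
  have hDu := continuous_ppTrueNumeratorDu_line hβ hΛ hB₁ D
  have hμ := continuous_midFactor_antidiag hκ hlo D
  have hμ' := continuous_midFactorD_antidiag hκ'c hlo D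
  obtain ⟨hρ, hrl⟩ := continuous_euler_and_lineDeriv_antidiag hlo D
  -- `Φ′` is continuous, hence interval-integrable, and the FTC applies
  have hΦ'c : Continuous fun e : ℝ =>
      ppTrueNumerator β Λ e (D - e) * (1 - κ (ppSmoothRatio lo e (D - e)) - κ (1 - ppSmoothRatio lo e (D - e))) +
        e * (ppTrueNumeratorDu β Λ (D - e) e - ppTrueNumeratorDu β Λ e (D - e)) * (1 - κ (ppSmoothRatio lo e (D - e)) - κ (1 - ppSmoothRatio lo e (D - e))) +
        e * ppTrueNumerator β Λ e (D - e) * ((κ' (1 - ppSmoothRatio lo e (D - e)) - κ' (ppSmoothRatio lo e (D - e))) *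
          (((e / ppSmoothScale lo e) * ppSmoothScale lo (D - e) + ppSmoothScale lo e * ((D - e) / ppSmoothScale lo (D - e))) /
            (ppSmoothScale lo e + ppSmoothScale lo (D - e)) ^ 2)) :=
    ((hN.mul hμ).add (((continuous_id.mul (hDe.sub hDu)).mul hμ))).add ((continuous_id.mul hN).mul (hμ'.mul hrl))
  have hFTC := intervalIntegral.integral_eq_sub_of_hasDerivAt (fun e _ => hasDerivAt_midPhi_antidiag hβ hΛ hB₁ hκ hlo D e) (hΦ'c.intervalIntegrable a b)
  -- the right-hand integrand is continuous
  have hRc : Continuous fun e : ℝ => (e * ppTrueNumeratorDu β Λ (D - e) e + (D - e) * ppTrueNumeratorDu β Λ e (D - e)) *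
      (1 - κ (ppSmoothRatio lo e (D - e)) - κ (1 - ppSmoothRatio lo e (D - e))) +
      ppTrueNumerator β Λ e (D - e) * (κ' (1 - ppSmoothRatio lo e (D - e)) - κ' (ppSmoothRatio lo e (D - e))) *
        (lo ^ 2 * (e ^ 2 - (D - e) ^ 2) / (ppSmoothScale lo e * ppSmoothScale lo (D - e) * (ppSmoothScale lo e + ppSmoothScale lo (D - e)) ^ 2)) :=
    (((continuous_id.mul hDe).add ((continuous_const.sub continuous_id).mul hDu)).mul hμ).add ((hN.mul hμ').mul hρ)
  -- pointwise identity under the integral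
  rw [← intervalIntegral.integral_const_mul]
  have hpt : ∀ e : ℝ, D ^ 2 * deriv (fun v : ℝ => ppMidKernelS β Λ κ lo e v) (D - e) = _ := fun e => midFlatness_pointwise_identity hβ hΛ hB₁ hκ hlo hD.ne' e
  simp_rw [hpt]
  rw [intervalIntegral.integral_sub (hRc.intervalIntegrable a b) (hΦ'c.intervalIntegrable a b), hFTC]

end Integral

/-! ## §5 Tools for the sizes (part 6) -/

/-- `0 < β` ⟹ `x·e^{−βx} ≤ 1/β` (all real `x`). [folklore] -/
theorem mul_exp_neg_le_inv {β : ℝ} (hβ : 0 < β) (x : ℝ) : x * Real.exp (-(β * x)) ≤ 1 / β := by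
  rw [le_div_iff₀ hβ]
  have h1 : β * x + 1 ≤ Real.exp (β * x) := Real.add_one_le_exp _
  have h2 : Real.exp (-(β * x)) * Real.exp (β * x) = 1 := by rw [← Real.exp_add]; simp
  nlinarith [Real.exp_pos (-(β * x)), Real.exp_pos (β * x)]

/-- `∫_0^L βx·e^{−βx} dx ≤ 1/β` (`0 ≤ L`). [folklore] -/
theorem integral_beta_mul_exp_le {β L : ℝ} (hβ : 0 < β) (hL : 0 ≤ L) : ∫ x in (0 : ℝ)..L, β * x * Real.exp (-(β * x)) ≤ 1 / β := by
  refine (integral_mul_exp_neg_mul_le hβ le_rfl hL).trans ?_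
  simp

/-- **`∫_c^d β|x|·e^{−β|x|} dx ≤ 2/β`** for any `c ≤ d`. [folklore] -/
theorem integral_beta_abs_exp_le {β c d : ℝ} (hβ : 0 < β) (hcd : c ≤ d) : ∫ x in c..d, β * |x| * Real.exp (-(β * |x|)) ≤ 2 / β := by
  set L : ℝ := max |c| |d| with hL
  have hL0 : 0 ≤ L := le_max_of_le_left (abs_nonneg c)
  have hcL : -L ≤ c := by have := neg_abs_le c; have := le_max_left |c| |d|; linarith
  have hdL : d ≤ L := (le_abs_self d).trans (le_max_right _ _)
  have hcont : Continuous fun x : ℝ => β * |x| * Real.exp (-(β * |x|)) := by fun_prop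
  have hnn : ∀ x, 0 ≤ β * |x| * Real.exp (-(β * |x|)) := fun x => by positivity
  have hmono : ∫ x in c..d, β * |x| * Real.exp (-(β * |x|)) ≤ ∫ x in (-L)..L, β * |x| * Real.exp (-(β * |x|)) :=
    intervalIntegral.integral_mono_interval hcL hcd hdL (Filter.Eventually.of_forall hnn) (hcont.intervalIntegrable _ _)
  refine hmono.trans ?_
  rw [← intervalIntegral.integral_add_adjacent_intervals (hcont.intervalIntegrable (-L) 0) (hcont.intervalIntegrable 0 L)]
  have hneg : ∫ x in (-L)..0, β * |x| * Real.exp (-(β * |x|)) = ∫ x in (0 : ℝ)..L, β * x * Real.exp (-(β * x)) := by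
    have h := intervalIntegral.integral_comp_neg (a := 0) (b := L) (fun x : ℝ => β * |x| * Real.exp (-(β * |x|)))
    simp only [neg_zero, abs_neg] at h
    rw [← h]
    refine intervalIntegral.integral_congr fun x hx => ?_
    rw [uIcc_of_le hL0] at hx
    simp only [abs_of_nonneg hx.1]
  have hpos : ∫ x in (0 : ℝ)..L, β * |x| * Real.exp (-(β * |x|)) = ∫ x in (0 : ℝ)..L, β * x * Real.exp (-(β * x)) := by
    refine intervalIntegral.integral_congr fun x hx => ?_
    rw [uIcc_of_le hL0] at hx
    simp only [abs_of_nonneg hx.1]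
  rw [hneg, hpos]
  have := integral_beta_mul_exp_le hβ hL0
  have e2 : (2 : ℝ) / β = 1 / β + 1 / β := by ring
  linarith

/-- `∫_a^b C/e² de ≤ C/a` (`0 < a ≤ b`, `0 ≤ C`). [folklore] -/
theorem intervalIntegral_const_div_sq_le {a b C : ℝ} (ha : 0 < a) (hab : a ≤ b) (hC : 0 ≤ C) : ∫ e in a..b, C / e ^ 2 ≤ C / a := by
  have hderiv : ∀ e ∈ uIcc a b, HasDerivAt (fun e : ℝ => -C * e⁻¹) (C / e ^ 2) e := fun e he => by
    rw [uIcc_of_le hab] at he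
    have he0 : e ≠ 0 := (ha.trans_le he.1).ne'
    have h := ((hasDerivAt_id e).inv he0).const_mul (-C)
    refine h.congr_deriv ?_
    simp only [id]; field_simp
  have hcont : ContinuousOn (fun e : ℝ => C / e ^ 2) (uIcc a b) := by
    refine continuousOn_const.div (continuousOn_pow 2) fun e he => ?_
    rw [uIcc_of_le hab] at he
    exact pow_ne_zero 2 (ha.trans_le he.1).ne'
  rw [intervalIntegral.integral_eq_sub_of_hasDerivAt hderiv (hcont.intervalIntegrable)]
  have hb : 0 ≤ C * b⁻¹ := by have := ha.trans_le hab; positivity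
  rw [div_eq_mul_inv]
  linarith


end Summit.HubbardSuperconductivity.HubbardSuperconductivity.Theorems.C4a

end
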